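import Mathlib
import HarnessLib
import Literature.Analysis.FluidPDE.EnergyToolkit
import Summits.NavierStokesRegularity.NavierStokesRegularity.Theorems.LocalSineTubeDoorLocalPointZoomGradSlices
import Summits.NavierStokesRegularity.NavierStokesRegularity.Theorems.LocalSineTubeDoorWindowFatouSeq
import Summits.NavierStokesRegularity.NavierStokesRegularity.Theorems.PoloidalWindowDoorPoloidalWindowRigidityWindow

/-!
# The one-window door family — the MOST-TIMES generic door: for EVERY all-slices profile crux, fading along all times
# outside an exceptional set of density `→ 0` at `T` suffices

Cell ns-regularity-ideate, seat p6 (route-directed support for nsreg-p1's door family; anchor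
`--supports stmt-NavierStokesRegularity-20017`).  The all-times template `…GenericDoor.genericDoor_of_profileWindowRigidity`
(p441820) asks the window scalar to fade as `t → T⁻` through ALL times; the sparse-time templates of KIT-INDEX-g4 §D
(`sequentialDoor_…`, `bandDoor_…`) need a ONE-SLICE profile crux.  This file closes the gap for the ALL-SLICES cruxes
(aligned window rigidity K2, poloidal K2, S10's K2′, S11's K2⁗, Beltrami, stretching, enstrophy production, …):

**`mostTimesGenericDoor_of_profileWindowRigidity`** — same `F`, `hF`, `hzero` and the same all-slices profile WINDOW
crux as the all-times template; hypothesis: an exceptional time set `E` with `|E ∩ (T−h, T)| ≤ ε h` for all small `h`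
(every `ε > 0`), and fading of the window scalar along EVERY sequence of times `tₖ → T` in `[0,T) ∖ E`; conclusion:
`IsBackwardBoundedAt u T x₀`.

Proof.  Zoom (`localPointZoomVelGradSlices`, one sequence `λⱼ → 0`).  For a slice `s < 0` call `s` GOOD if the zoom
times `tⱼ(s) = T + λⱼ² s/ν` leave `E` infinitely often; along that subsequence the hypothesis gives the fading, and the
sequence-form window Fatou lemma (`…WindowFatouSeq.windowFatou_firstOrder_seq`) gives `F = 0` on the window of the
slice `s`.  GOOD slices are DENSE in `(−∞, 0)`: if every `s ∈ (a, b)` (`b < 0`) were bad, `(a,b) = ⋃_N B_N` with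
`B_N = {s : tⱼ(s) ∈ E ∀ j ≥ N}`, some `B_N` has positive measure `δ`, but `B_N ⊆ tⱼ⁻¹(E ∩ (T − λⱼ²|a|/ν, T))` has
measure `≤ (ν/λⱼ²)·ε·λⱼ²|a|/ν = ε|a|` for large `j` (affine change of variables `Real.volume_preimage_mul_left`,
`measure_preimage_add`; density hypothesis at `h = λⱼ²|a|/ν → 0⁺`) — a contradiction for `ε|a| < δ`.  Finally the
profile scalar is jointly continuous in `(s, y)` on the open slab (joint smoothness of the class), so `F = 0` on the
windows of ALL slices, and the zero-set invariance puts it in the crux's form.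

WHAT THIS IS NOT: not a claim about Navier–Stokes regularity; a door TEMPLATE (conditional on the profile crux given as
a hypothesis and on local Type I), bears_on LADDER-NS N0.
-/

noncomputable section

-- the summit and its single sub-problem share the name (CONVENTIONS §1), as in every Theorems file
set_option linter.dupNamespace false

namespace Summit.NavierStokesRegularity.NavierStokesRegularity.Theorems.LocalSineTubeDoorMostTimesGenericDoor

open MeasureTheory Set Function Filter Topology TopologicalSpace Metric
open scoped RealInnerProductSpace InnerProductSpace NNReal ENNReal
open Literature.Analysis Literature.Analysis.FluidPDE
open Summit.NavierStokesRegularity.NavierStokesRegularity.Theorems.LocalSineTubeDoorLocalPointZoomGradSlices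
open Summit.NavierStokesRegularity.NavierStokesRegularity.Theorems.LocalSineTubeDoorWindowFatouSeq
open Summit.NavierStokesRegularity.NavierStokesRegularity.Theorems.PoloidalWindowDoorPoloidalWindowRigidityWindow

/-- **Affine change of variables for the zoom times**: for `c > 0`,
`volume {s ∈ (a,b) : T + c s ∈ A} ≤ c⁻¹ · volume (A ∩ (T + c a, T + c b))` — in fact
`volume ((s ↦ T + c s)⁻¹' A') = c⁻¹ volume A'` for every set `A'` (`Real.volume_preimage_mul_left`, `measure_preimage_add`). -/
theorem volume_preimage_affine (T c : ℝ) (hc : 0 < c) (A : Set ℝ) :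
    volume ((fun s : ℝ => T + c * s) ⁻¹' A) = ENNReal.ofReal c⁻¹ * volume A := by
  have h1 : (fun s : ℝ => T + c * s) ⁻¹' A = (fun s : ℝ => c * s) ⁻¹' ((fun x : ℝ => T + x) ⁻¹' A) := by
    ext s; simp
  rw [h1, Real.volume_preimage_mul_left hc.ne', measure_preimage_add, abs_of_pos (inv_pos.2 hc)]

/-- **THE MOST-TIMES GENERIC FIRST-ORDER DOOR ⇐ ITS ALL-SLICES PROFILE WINDOW CRUX.**  See the module docstring. -/
theorem mostTimesGenericDoor_of_profileWindowRigidity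
    (F : EuclideanSpace ℝ (Fin 3) → (EuclideanSpace ℝ (Fin 3) →L[ℝ] EuclideanSpace ℝ (Fin 3)) → ℝ)
    (hF : Continuous fun q : EuclideanSpace ℝ (Fin 3) × (EuclideanSpace ℝ (Fin 3) →L[ℝ] EuclideanSpace ℝ (Fin 3)) =>
      F q.1 q.2)
    (hzero : ∀ (a b : ℝ), 0 < a → 0 < b → ∀ (x : EuclideanSpace ℝ (Fin 3))
      (A : EuclideanSpace ℝ (Fin 3) →L[ℝ] EuclideanSpace ℝ (Fin 3)), F (a • x) (b • A) = 0 ↔ F x A = 0)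
    (hcrux : ∀ (C : ℝ) (v : ℝ → EuclideanSpace ℝ (Fin 3) → EuclideanSpace ℝ (Fin 3)),
      Literature.Analysis.FluidPDE.HasTypeITimeDecay C v →
      ContinuousOn (Function.uncurry v) (Set.Iio (0 : ℝ) ×ˢ Set.univ) →
      (∀ s t : ℝ, s < t → t < 0 → ∀ x, v t x =
        Literature.Analysis.UnboundedOperators.heatExtension (v s) (t - s) x -
          Literature.Analysis.FluidPDE.oseenDuhamel 1 s v v t x) →
      (∀ t < 0, Literature.Analysis.FluidPDE.VectorCalculus.IsDivFree (v t)) →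
      (∀ s < 0, ∃ U : Set (EuclideanSpace ℝ (Fin 3)), IsOpen U ∧ U.Nonempty ∧
        ∀ z ∈ U, F (v s z) (fderiv ℝ (v s) z) = 0) →
      ¬ Literature.Analysis.FluidPDE.IsBackwardSingularPoint v 0) :
    ∀ (ν T : ℝ), 0 < ν → 0 < T → ∀ (u : ℝ → EuclideanSpace ℝ (Fin 3) → EuclideanSpace ℝ (Fin 3))
      (p : ℝ → EuclideanSpace ℝ (Fin 3) → ℝ),
    Literature.Analysis.FluidPDE.IsClassicalNSSolutionOn (Set.Ico 0 T) ν 0 u p →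
    Literature.Analysis.FluidPDE.IsLerayHopfOn T ν 0 (u 0) u →
    Literature.Analysis.FluidPDE.HasRapidSpatialDecay (u 0) →
    ∀ (x₀ : EuclideanSpace ℝ (Fin 3)) (ρ M : ℝ), 0 < ρ →
    (∀ t ∈ Set.Ico 0 T, T - ρ ^ 2 < t → ∀ x ∈ Metric.ball x₀ ρ, ‖u t x‖ * Real.sqrt (ν * (T - t)) ≤ M) →
    ∀ (U : Set (EuclideanSpace ℝ (Fin 3))), IsOpen U → U.Nonempty →
    ∀ (E : Set ℝ), (∀ ε > 0, ∀ᶠ h in nhdsWithin (0 : ℝ) (Set.Ioi 0),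
      MeasureTheory.volume (E ∩ Set.Ioo (T - h) T) ≤ ENNReal.ofReal (ε * h)) →
    (∀ t : ℕ → ℝ, (∀ k, t k ∈ Set.Ico 0 T ∧ t k ∉ E) → Filter.Tendsto t Filter.atTop (nhds T) →
      Filter.Tendsto (fun k => ∫⁻ y in U, ENNReal.ofReal
        |F (Real.sqrt (T - t k) • u (t k) (x₀ + Real.sqrt (T - t k) • y))
          (Real.sqrt (T - t k) ^ 2 • fderiv ℝ (u (t k)) (x₀ + Real.sqrt (T - t k) • y))|)
        Filter.atTop (nhds 0)) →
    Literature.Analysis.FluidPDE.IsBackwardBoundedAt u T x₀ := by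
  intro ν T hν hT u p hcl hLH hdec x₀ ρ M hρ hM U hU hUne E hE hfadeE
  by_contra hnot
  obtain ⟨C, v, lam, hlam, hlam0, ⟨hrate, hcont, hmild, hdiv⟩, hsing, hconv⟩ :=
    localPointZoomVelGradSlices ν T hν hT u p hcl hLH hdec x₀ ρ M hρ hM hnot
  -- the window scalar of the profile in similarity coordinates, at the slice `s` and the window point `y`
  set H : ℝ → EuclideanSpace ℝ (Fin 3) → ℝ := fun s y =>
    F ((Real.sqrt (-s) / Real.sqrt ν * ν) • v s ((Real.sqrt (-s) / Real.sqrt ν) • y))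
      (((Real.sqrt (-s) / Real.sqrt ν) ^ 2 * ν) • fderiv ℝ (v s) ((Real.sqrt (-s) / Real.sqrt ν) • y)) with hHdef
  -- the zoom times at the slice `s` tend to `T` from below
  have hlt : ∀ s < 0, ∀ j, T + lam j ^ 2 * s / ν < T := fun s hs j => by
    have : lam j ^ 2 * s / ν < 0 := div_neg_of_neg_of_pos (mul_neg_of_pos_of_neg (pow_pos (hlam j) 2) hs) hν
    linarith
  have htend : ∀ s : ℝ, Tendsto (fun j => T + lam j ^ 2 * s / ν) atTop (𝓝 T) := fun s => by
    have h := (((hlam0.pow 2).mul_const s).div_const ν).const_add T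
    simpa using h
  -- ## Step 1: GOOD slices (zoom times leave `E` infinitely often) carry `H(s, ·) = 0` on `U`
  have hgood : ∀ s < 0, (∃ᶠ j in atTop, T + lam j ^ 2 * s / ν ∉ E) → ∀ y ∈ U, H s y = 0 := by
    intro s hs hfreq y hy
    have hev : ∀ᶠ j in atTop, T + lam j ^ 2 * s / ν ∈ Set.Ico 0 T := by
      filter_upwards [(htend s).eventually (Ici_mem_nhds hT)] with j hj
      exact ⟨hj, hlt s hs j⟩
    obtain ⟨φ, hφ, hφP⟩ := extraction_of_frequently_atTop (hfreq.and_eventually hev)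
    have hlam' : ∀ k, 0 < (lam ∘ φ) k := fun k => hlam (φ k)
    have hlam0' : Tendsto (lam ∘ φ) atTop (𝓝 0) := hlam0.comp hφ.tendsto_atTop
    have hconv' : ∀ s' < 0, ∀ y',
        Tendsto (fun k => ((lam ∘ φ) k / ν) • u (T + (lam ∘ φ) k ^ 2 * s' / ν) (x₀ + (lam ∘ φ) k • y')) atTop
          (𝓝 (v s' y')) ∧
        Tendsto (fun k => ((lam ∘ φ) k ^ 2 / ν) • fderiv ℝ (u (T + (lam ∘ φ) k ^ 2 * s' / ν))
          (x₀ + (lam ∘ φ) k • y')) atTop (𝓝 (fderiv ℝ (v s') y')) := fun s' hs' y' =>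
      ⟨(hconv s' hs' y').1.comp hφ.tendsto_atTop, (hconv s' hs' y').2.comp hφ.tendsto_atTop⟩
    have hmem : ∀ k, T + (lam ∘ φ) k ^ 2 * s / ν ∈ Set.Ico 0 T := fun k => (hφP k).2
    have hfadej := hfadeE (fun k => T + (lam ∘ φ) k ^ 2 * s / ν) (fun k => ⟨(hφP k).2, (hφP k).1⟩)
      ((htend s).comp hφ.tendsto_atTop)
    exact windowFatou_firstOrder_seq hν hcl hlam' hlam0' hrate hcont hmild hconv' F hF hU hs hmem hfadej hy
  -- ## Step 2: GOOD slices are dense in `(−∞, 0)`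
  have hdense : ∀ a b : ℝ, a < b → b < 0 → ∃ s ∈ Set.Ioo a b, ∃ᶠ j in atTop, T + lam j ^ 2 * s / ν ∉ E := by
    intro a b hab hb
    have ha : 0 < -a := by linarith
    by_contra hnone
    have hnone' : ∀ s ∈ Set.Ioo a b, ∀ᶠ j in atTop, T + lam j ^ 2 * s / ν ∈ E := by
      intro s hs
      have h : ¬ ∃ᶠ j in atTop, T + lam j ^ 2 * s / ν ∉ E := fun hf => hnone ⟨s, hs, hf⟩
      simpa only [Filter.not_frequently, not_not] using h
    -- `B N = {s ∈ (a,b) : tⱼ(s) ∈ E for all j ≥ N}` cover `(a,b)`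
    set B : ℕ → Set ℝ := fun N => {s | s ∈ Set.Ioo a b ∧ ∀ j, N ≤ j → T + lam j ^ 2 * s / ν ∈ E} with hB
    have hcover : Set.Ioo a b ⊆ ⋃ N, B N := by
      intro s hs
      obtain ⟨N, hN⟩ := eventually_atTop.1 (hnone' s hs)
      exact Set.mem_iUnion.2 ⟨N, hs, hN⟩
    -- some `B N` has positive (outer) measure
    have hpos : ∃ N, 0 < volume (B N) := by
      by_contra hall
      push Not at hall
      have h0 : volume (⋃ N, B N) = 0 := measure_iUnion_null fun N => nonpos_iff_eq_zero.1 (hall N)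
      have h1 : volume (Set.Ioo a b) = 0 := measure_mono_null hcover h0
      rw [Real.volume_Ioo] at h1
      have h2 : 0 < ENNReal.ofReal (b - a) := ENNReal.ofReal_pos.2 (by linarith)
      exact h2.ne' h1
    obtain ⟨N, hN⟩ := hpos
    set δ : ℝ≥0∞ := volume (B N) with hδ
    have hδfin : δ < ∞ := by
      refine lt_of_le_of_lt (measure_mono (fun s hs => hs.1) : volume (B N) ≤ volume (Set.Ioo a b)) ?_
      rw [Real.volume_Ioo]; exact ENNReal.ofReal_lt_top
    have hδreal : 0 < δ.toReal := ENNReal.toReal_pos hN.ne' hδfin.ne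
    -- the density hypothesis at `ε = δ/(2|a|)` along `hⱼ = λⱼ²|a|/ν → 0⁺`
    set ε : ℝ := δ.toReal / (2 * (-a)) with hεdef
    have hε : 0 < ε := div_pos hδreal (by positivity)
    have hh : Tendsto (fun j => lam j ^ 2 * (-a) / ν) atTop (nhdsWithin (0 : ℝ) (Set.Ioi 0)) := by
      refine tendsto_nhdsWithin_iff.2 ⟨?_, Eventually.of_forall fun j => ?_⟩
      · simpa using ((hlam0.pow 2).mul_const (-a)).div_const ν
      · exact div_pos (mul_pos (pow_pos (hlam j) 2) ha) hν
    obtain ⟨j, hjd, hjN⟩ := ((hh.eventually (hE ε hε)).and (eventually_ge_atTop N)).exists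
    -- `B N ⊆ (s ↦ T + (λⱼ²/ν) s)⁻¹' (E ∩ (T − hⱼ, T))`
    have hc : 0 < lam j ^ 2 / ν := div_pos (pow_pos (hlam j) 2) hν
    have hsub : B N ⊆ (fun s : ℝ => T + lam j ^ 2 / ν * s) ⁻¹' (E ∩ Set.Ioo (T - lam j ^ 2 * (-a) / ν) T) := by
      intro s hs
      have e1 : T + lam j ^ 2 / ν * s = T + lam j ^ 2 * s / ν := by ring
      show T + lam j ^ 2 / ν * s ∈ E ∩ Set.Ioo (T - lam j ^ 2 * (-a) / ν) T
      refine ⟨by rw [e1]; exact hs.2 j hjN, ?_, ?_⟩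
      · have h1 : lam j ^ 2 / ν * a < lam j ^ 2 / ν * s := mul_lt_mul_of_pos_left hs.1.1 hc
        have h2 : T - lam j ^ 2 * (-a) / ν = T + lam j ^ 2 / ν * a := by ring
        linarith
      · have : lam j ^ 2 / ν * s < 0 := mul_neg_of_pos_of_neg hc (hs.1.2.trans hb)
        linarith
    have hbound : δ ≤ ENNReal.ofReal (ε * (-a)) := by
      have hl : lam j ≠ 0 := (hlam j).ne'
      have hνne : ν ≠ 0 := hν.ne'
      calc δ ≤ volume ((fun s : ℝ => T + lam j ^ 2 / ν * s) ⁻¹' (E ∩ Set.Ioo (T - lam j ^ 2 * (-a) / ν) T)) :=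
            measure_mono hsub
        _ = ENNReal.ofReal (lam j ^ 2 / ν)⁻¹ * volume (E ∩ Set.Ioo (T - lam j ^ 2 * (-a) / ν) T) :=
            volume_preimage_affine T _ hc _
        _ ≤ ENNReal.ofReal (lam j ^ 2 / ν)⁻¹ * ENNReal.ofReal (ε * (lam j ^ 2 * (-a) / ν)) := by
            gcongr
        _ = ENNReal.ofReal (ε * (-a)) := by
            rw [← ENNReal.ofReal_mul (inv_nonneg.2 hc.le)]
            congr 1
            field_simp
    have hlt' : ENNReal.ofReal (ε * (-a)) < δ := by
      have e : ε * (-a) = δ.toReal / 2 := by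
        rw [hεdef]
        field_simp
        exact div_self (by linarith : a ≠ 0)
      rw [e]
      calc ENNReal.ofReal (δ.toReal / 2) < ENNReal.ofReal δ.toReal :=
            (ENNReal.ofReal_lt_ofReal_iff hδreal).2 (by linarith)
        _ = δ := ENNReal.ofReal_toReal hδfin.ne
    exact absurd (hbound.trans_lt hlt') (lt_irrefl _)
  -- ## Step 3: continuity of `s ↦ H(s, y)` on `(−∞, 0)` and `H = 0` for ALL slices
  have hA : IsTypeIAncientMild C v := isTypeIAncientMild_of_class hrate hcont hmild hdiv
  have hDcont : ContinuousOn (uncurry fun t x => fderiv ℝ (v t) x) (Iio (0 : ℝ) ×ˢ univ) :=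
    ((show IsSmoothSpaceTimeOn (Iio 0) v from hA.contDiffOn).fderiv_slice isOpen_Iio.uniqueDiffOn).continuousOn
  have hHcont : ∀ y, ContinuousOn (fun s => H s y) (Iio 0) := by
    intro y
    have hσ : Continuous fun s : ℝ => Real.sqrt (-s) / Real.sqrt ν :=
      (Real.continuous_sqrt.comp continuous_neg).div_const _
    have hpath : ContinuousOn (fun s : ℝ => (s, (Real.sqrt (-s) / Real.sqrt ν) • y)) (Iio 0) :=
      (continuousOn_id.prodMk (hσ.smul continuous_const).continuousOn)
    have hmaps : MapsTo (fun s : ℝ => (s, (Real.sqrt (-s) / Real.sqrt ν) • y)) (Iio 0) (Iio (0 : ℝ) ×ˢ univ) :=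
      fun s hs => ⟨hs, mem_univ _⟩
    have hv' : ContinuousOn (fun s : ℝ => v s ((Real.sqrt (-s) / Real.sqrt ν) • y)) (Iio 0) :=
      hcont.comp hpath hmaps
    have hD' : ContinuousOn (fun s : ℝ => fderiv ℝ (v s) ((Real.sqrt (-s) / Real.sqrt ν) • y)) (Iio 0) :=
      hDcont.comp hpath hmaps
    have h1 : ContinuousOn (fun s : ℝ => (Real.sqrt (-s) / Real.sqrt ν * ν) • v s ((Real.sqrt (-s) / Real.sqrt ν) • y))
        (Iio 0) := (hσ.mul continuous_const).continuousOn.smul hv'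
    have h2 : ContinuousOn (fun s : ℝ => ((Real.sqrt (-s) / Real.sqrt ν) ^ 2 * ν) •
        fderiv ℝ (v s) ((Real.sqrt (-s) / Real.sqrt ν) • y)) (Iio 0) :=
      ((hσ.pow 2).mul continuous_const).continuousOn.smul hD'
    exact hF.comp_continuousOn (h1.prodMk h2)
  have hall : ∀ s < 0, ∀ y ∈ U, H s y = 0 := by
    intro s₀ hs₀ y hy
    by_contra hne
    have hevne : ∀ᶠ s in nhdsWithin s₀ (Iio 0), H s y ≠ 0 := (hHcont y s₀ hs₀).eventually_ne hne
    obtain ⟨δ, hδ, hball⟩ := Metric.mem_nhdsWithin_iff.1 hevne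
    obtain ⟨s, hs, hfreq⟩ := hdense (s₀ - δ / 2) s₀ (by linarith) hs₀
    have hs0 : s < 0 := hs.2.trans hs₀
    have hdist : dist s s₀ < δ := by
      rw [Real.dist_eq, abs_sub_lt_iff]; constructor <;> linarith [hs.1, hs.2]
    exact hball ⟨Metric.mem_ball.2 hdist, hs0⟩ (hgood s hs0 hfreq y hy)
  -- ## Step 4: the crux's windows
  refine hcrux C v hrate hcont hmild hdiv (fun s hs => ?_) hsing
  have hns : 0 < -s := neg_pos.2 hs
  set σ : ℝ := Real.sqrt (-s) / Real.sqrt ν with hσdef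
  have hσpos : 0 < σ := div_pos (Real.sqrt_pos.2 hns) (Real.sqrt_pos.2 hν)
  refine ⟨(fun z => σ⁻¹ • z) ⁻¹' U, hU.preimage (continuous_const_smul σ⁻¹), ?_, fun z hz => ?_⟩
  · obtain ⟨u₀, hu₀⟩ := hUne
    refine ⟨σ • u₀, ?_⟩
    show σ⁻¹ • (σ • u₀) ∈ U
    rwa [smul_smul, inv_mul_cancel₀ hσpos.ne', one_smul]
  · have h := hall s hs (σ⁻¹ • z) hz
    simp only [hHdef] at h
    rw [← hσdef, smul_smul, mul_inv_cancel₀ hσpos.ne', one_smul] at h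
    exact (hzero _ _ (mul_pos hσpos hν) (mul_pos (pow_pos hσpos 2) hν) _ _).1 h

end Summit.NavierStokesRegularity.NavierStokesRegularity.Theorems.LocalSineTubeDoorMostTimesGenericDoor

end
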